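import Mathlib.RingTheory.SimpleModule.WedderburnArtin
import Mathlib.RingTheory.FiniteLength
import Mathlib.RingTheory.Length
import HarnessLib

/-!
# A finite-length abelian category all of whose endomorphism rings are semisimple is semisimple
# (Kottwitz 1992, Lemma 3.1), for the category of modules of finite length over a ring

[topic RingTheory/SimpleModule]

Layer `Literature/RingTheory/SimpleModule`, namespace `Literature.RingTheory.SimpleModule` (lane `lit-hodgefound`,
Track 2 foundations; seat `lit-hodgefound-p11`, generation 30, row g30-#1).  THEOREMS ONLY (D-0026): no definition, no
named fact, no instance.

THE PRINT.  R. E. Kottwitz, *Points on some Shimura varieties over finite fields*, J. Amer. Math. Soc. 5 (1992)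
[Kottwitz1992] §3 p. 383 (held text `paper:doi-10-2307-2152772` p0011 L1–L33), verbatim: «… the endomorphism ring of any
semisimple object is a semisimple ring.  Recall that `𝒞` is said to be semisimple if all its objects are semisimple.  If
`𝒞` is semisimple, then for every object `X` of `𝒞` the endomorphism ring `End(X)` is semisimple.  There is also a
converse.

LEMMA 3.1. *Suppose that for every object `X` of `𝒞` the endomorphism ring `End(X)` is semisimple.  Then `𝒞` is
semisimple.*

We prove that any object `Y` of `𝒞` is semisimple by induction on the length of `Y`.  If the length is `0` or `1`, there
is nothing to do; so we assume that the length is strictly greater than `1`.  Let `Z` be a subobject of `Y` such that the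
quotient `X := Y/Z` is simple, and let `p` be the canonical map from `Y` to `X`.  By the induction hypothesis `Z` is
semisimple.  We will assume that `Y` is not semisimple and get a contradiction.  Every simple subobject of `Y` must be
contained in `Z` (otherwise we could write `Y` as the direct sum of `Z` and the simple subobject).  Therefore `Z` can be
characterized as the sum of all the simple subobjects of `Y`.  Therefore any endomorphism of `Y` preserves `Z`.  Hence we
get a homomorphism from `End(Y)` to `End(Z) × End(X)`, whose kernel is `Hom(X, Z)` with multiplication given by `fg = 0`
for all `f, g ∈ Hom(X, Z)`.  On the other hand this kernel is a two-sided ideal in the semisimple ring `End(Y)`, and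
therefore `Hom(X, Z) = 0`.  Our next step is to show that `Hom(X, Y) = 0`.  Let `f ∈ Hom(X, Y)`.  If `p ∘ f ≠ 0`, then
since `End(X)` is a division ring, we could modify `f` on the right so as to get a new `f` with `p ∘ f = id_X`.  Then `Y`
would be the direct sum of `Z` and `X`, and hence would be semisimple, a contradiction.  Therefore `p ∘ f = 0`, which
just says that `f` factors through the subobject `Z` of `Y`.  Since we already know that `Hom(X, Z) = 0`, we conclude
that `f = 0`, as desired.  Now consider the ring `End(X ⊕ Y)`.  Since `Hom(X, Y) = 0`, the semisimple ring `End(X ⊕ Y)`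
has as two-sided ideal the group `Hom(Y, X)` with the zero multiplication law, and therefore `Hom(Y, X) = 0`.  This is a
contradiction, since `p` is a nonzero element of `Hom(Y, X)`.»  (Here `𝒞` is an abelian category in which every object
has finite length, loc. cit. p. 382 bottom; §3 then applies the lemma to the categories `𝒞_B` of `B`-objects, Lemma 3.2,
on the way to the Honda–Tate classification used for the PEL moduli problems of §5.)

THE SETTING HERE.  `𝒞` = the `R`-modules of finite length over an arbitrary ring `R` (Mathlib's `IsFiniteLength R M`,
equivalently `IsNoetherian R M ∧ IsArtinian R M`), `End(Y)` = `Module.End R Y`, «semisimple ring» = Mathlib's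
`IsSemisimpleRing` (semisimple as a left module over itself), «semisimple object» = `IsSemisimpleModule R Y`
(complemented submodule lattice).  All objects range over ONE universe, so that `Z ⊆ Y`, `X = Y ⧸ Z` and `X ⊕ Y` are again
objects of `𝒞`.

THE PROOF FOLLOWED, and where we deviate.  We follow the printed induction verbatim, with two simplifications that the
module setting offers: (i) «every simple subobject of `Y` lies in `Z`» and «any endomorphism of `Y` preserves `Z`» are
both instances of ONE remark — a SEMISIMPLE subobject `N ⊆ Y` not contained in the maximal subobject `Z` has `N + Z = Y`,
and a sum of two semisimple submodules is semisimple (Mathlib's `IsSemisimpleModule.sup`), contradicting the standing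
assumption; apply it to `N` simple, to `N = f(Z)` (a quotient of the semisimple `Z`) and to `N = f(X)` for
`f ∈ Hom(X, Y)` (a quotient of the simple `X`) — the last replaces Kottwitz's splitting `p ∘ f = id_X` (so `End(X)` being
a division ring is not needed); (ii) the ring-theoretic input «a two-sided ideal with zero multiplication in a semisimple
ring is `0`» is used for LEFT ideals, where it follows from Mathlib's `IsSemisimpleRing.ideal_eq_span_idempotent` (a left
ideal of a semisimple ring is generated by an idempotent `e`, and `e = e² ∈ I² = 0`).  The induction on the length uses
Mathlib's `Module.length` (`Submodule.length_lt`).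

WHAT IS PROVED.
§0 `ideal_eq_bot_of_forall_mul_eq_zero` — a square-zero left ideal of a semisimple ring is zero.
§1 (the core of the printed proof, LENGTH-FREE: `Z ⊆ Y` a maximal submodule which is semisimple, `End(Y)` and
   `End(Y⧸Z ⊕ Y)` semisimple rings) `le_of_isCoatom_of_isSemisimpleModule` («every [semi]simple subobject of `Y` must be
   contained in `Z`»), `map_le_of_isCoatom` («any endomorphism of `Y` preserves `Z`»), `eq_zero_of_range_le_of_le_ker`
   («`Hom(X, Z) = 0`»), `eq_zero_of_le_ker` («`Hom(X, Y) = 0`»), and **`isSemisimpleModule_of_isCoatom`** (the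
   contradiction in `End(X ⊕ Y)`: `Y` IS semisimple).
§2 **`isSemisimpleModule_of_forall_isSemisimpleRing_moduleEnd`** — LEMMA 3.1 AS PRINTED for `𝒞 = ` finite-length
   `R`-modules (induction on `Module.length`), and the biconditional **`forall_isSemisimpleModule_iff_forall_isSemisimpleRing_moduleEnd`**
   («If `𝒞` is semisimple, then … `End(X)` is semisimple.  There is also a converse.» — the forward direction is Mathlib's
   `IsSemisimpleRing.moduleEnd`).

## References

* [Kottwitz1992] R. E. Kottwitz, *Points on some Shimura varieties over finite fields*, J. Amer. Math. Soc. 5 (1992)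
  373–444, §3 Lemma 3.1 (p. 383).

## Provenance

Lane `lit-hodgefound` (HOME `run/shared/lean/pub/lit-hodgefound/`), prover seat `lit-hodgefound-p11` (gen 30),
self-proposed row g30-#1 (lane INBOX claim l.45322, 2026-08-27).
-/

set_option autoImplicit false

universe u v

namespace Literature.RingTheory.SimpleModule

open Submodule LinearMap

/-! ## §0 Square-zero left ideals of a semisimple ring -/

section SquareZero

variable {A : Type u} [Ring A]

/-- **A square-zero left ideal of a semisimple ring is zero**: every left ideal of a semisimple ring is generated by an
idempotent `e` [Mathlib `IsSemisimpleRing.ideal_eq_span_idempotent`], and `e = e·e = 0`.  This is the input «this kernel is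
a two-sided ideal in the semisimple ring `End(Y)` [with zero multiplication], and therefore … `= 0`» of the printed
proof. [cite: Kottwitz1992, §3 Lemma 3.1 (proof, p. 383)] -/
theorem ideal_eq_bot_of_forall_mul_eq_zero [IsSemisimpleRing A] (I : Ideal A)
    (h : ∀ x ∈ I, ∀ y ∈ I, x * y = 0) : I = ⊥ := by
  obtain ⟨e, he, rfl⟩ := IsSemisimpleRing.ideal_eq_span_idempotent I
  have hmem : e ∈ Ideal.span ({e} : Set A) := Ideal.subset_span rfl
  have he0 : e = 0 := by rw [← he.eq]; exact h e hmem e hmem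
  rw [he0, Ideal.span_singleton_eq_bot]

/-- Element form of `ideal_eq_bot_of_forall_mul_eq_zero`: every member of a square-zero left ideal of a semisimple
ring vanishes. [cite: Kottwitz1992, §3 Lemma 3.1 (proof, p. 383)] -/
theorem eq_zero_of_mem_of_forall_mul_eq_zero [IsSemisimpleRing A] {I : Ideal A}
    (h : ∀ x ∈ I, ∀ y ∈ I, x * y = 0) {x : A} (hx : x ∈ I) : x = 0 := by
  have hI := ideal_eq_bot_of_forall_mul_eq_zero I h
  rw [hI] at hx
  exact (Submodule.mem_bot A).mp hx

end SquareZero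

/-! ## §1 The core of the printed proof: a non-semisimple `Y` with semisimple maximal subobject `Z` is impossible -/

section Core

variable {R : Type u} [Ring R] {Y : Type v} [AddCommGroup Y] [Module R Y]

/-- «Every simple subobject of `Y` must be contained in `Z` (otherwise we could write `Y` as the direct sum of `Z` and the
simple subobject)», in the form the module setting gives for free: if `Y` is NOT semisimple and `Z ⊆ Y` is a maximal
submodule which is semisimple, then every SEMISIMPLE submodule `N ⊆ Y` lies in `Z` — otherwise `N + Z = Y` would be
semisimple (a sum of two semisimple submodules is semisimple). [cite: Kottwitz1992, §3 Lemma 3.1 (proof, p. 383)] -/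
theorem le_of_isCoatom_of_isSemisimpleModule {Z : Submodule R Y} (hZ : IsCoatom Z)
    (hZss : IsSemisimpleModule R Z) (hY : ¬ IsSemisimpleModule R Y) {N : Submodule R Y}
    (hN : IsSemisimpleModule R N) : N ≤ Z := by
  by_contra hNZ
  have hlt : Z < N ⊔ Z := lt_of_le_of_ne le_sup_right fun h => hNZ (le_sup_left.trans h.ge)
  have hsup : N ⊔ Z = ⊤ := hZ.2 _ hlt
  have htop : IsSemisimpleModule R (⊤ : Submodule R Y) := by
    rw [← hsup]
    exact IsSemisimpleModule.sup hN hZss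
  exact hY (IsSemisimpleModule.congr (Submodule.topEquiv (R := R) (M := Y)).symm)

/-- The printed form: every SIMPLE submodule of a non-semisimple `Y` lies in the semisimple maximal submodule `Z`.
[cite: Kottwitz1992, §3 Lemma 3.1 (proof, p. 383)] -/
theorem le_of_isCoatom_of_isSimpleModule {Z : Submodule R Y} (hZ : IsCoatom Z)
    (hZss : IsSemisimpleModule R Z) (hY : ¬ IsSemisimpleModule R Y) (S : Submodule R Y)
    [IsSimpleModule R S] : S ≤ Z :=
  le_of_isCoatom_of_isSemisimpleModule hZ hZss hY inferInstance

/-- «Therefore any endomorphism of `Y` preserves `Z`»: `f(Z) ⊆ Z` for every `f ∈ End(Y)` (`f(Z)` is a quotient of the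
semisimple `Z`, hence semisimple, hence inside `Z`). [cite: Kottwitz1992, §3 Lemma 3.1 (proof, p. 383)] -/
theorem map_le_of_isCoatom {Z : Submodule R Y} (hZ : IsCoatom Z) (hZss : IsSemisimpleModule R Z)
    (hY : ¬ IsSemisimpleModule R Y) (f : Module.End R Y) : Z.map f ≤ Z := by
  haveI := hZss
  have hrange : LinearMap.range (f ∘ₗ Z.subtype) = Z.map f := by
    rw [LinearMap.range_comp, Submodule.range_subtype]
  have hss : IsSemisimpleModule R (Z.map f) := by
    rw [← hrange]
    exact IsSemisimpleModule.range (f ∘ₗ Z.subtype)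
  exact le_of_isCoatom_of_isSemisimpleModule hZ hZss hY hss

/-- «Hence we get a homomorphism from `End(Y)` to `End(Z) × End(X)`, whose kernel is `Hom(X, Z)` with multiplication given
by `fg = 0` … this kernel is a two-sided ideal in the semisimple ring `End(Y)`, and therefore `Hom(X, Z) = 0`»: an
endomorphism `g` of `Y` with `g(Y) ⊆ Z` and `g(Z) = 0` is zero.  (The set of such `g` is a left ideal of `End(Y)` by
`map_le_of_isCoatom`, and the product of any two of its members is `0`; §0 applies.)
[cite: Kottwitz1992, §3 Lemma 3.1 (proof, p. 383)] -/
theorem eq_zero_of_range_le_of_le_ker [IsSemisimpleRing (Module.End R Y)] {Z : Submodule R Y} (hZ : IsCoatom Z)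
    (hZss : IsSemisimpleModule R Z) (hY : ¬ IsSemisimpleModule R Y) {g : Module.End R Y}
    (hgr : LinearMap.range g ≤ Z) (hgk : Z ≤ LinearMap.ker g) : g = 0 := by
  -- the kernel `Hom(X, Z)` of `End(Y) → End(Z) × End(X)`, as a left ideal of `End(Y)`
  let K : Ideal (Module.End R Y) :=
    { carrier := {g | LinearMap.range g ≤ Z ∧ Z ≤ LinearMap.ker g}
      add_mem' := by
        rintro a b ⟨har, hak⟩ ⟨hbr, hbk⟩
        refine ⟨?_, ?_⟩
        · intro y hy
          obtain ⟨x, rfl⟩ := LinearMap.mem_range.mp hy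
          exact Z.add_mem (har (LinearMap.mem_range_self a x)) (hbr (LinearMap.mem_range_self b x))
        · intro z hz
          rw [LinearMap.mem_ker, LinearMap.add_apply, LinearMap.mem_ker.mp (hak hz), LinearMap.mem_ker.mp (hbk hz),
            add_zero]
      zero_mem' := ⟨by rw [LinearMap.range_zero]; exact bot_le, by rw [LinearMap.ker_zero]; exact le_top⟩
      smul_mem' := by
        rintro c a ⟨har, hak⟩
        refine ⟨?_, ?_⟩
        · -- `range (c ∘ a) = c(range a) ⊆ c(Z) ⊆ Z`
          rw [smul_eq_mul, Module.End.mul_eq_comp, LinearMap.range_comp]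
          exact (Submodule.map_mono har).trans (map_le_of_isCoatom hZ hZss hY c)
        · rw [smul_eq_mul, Module.End.mul_eq_comp]
          exact hak.trans (LinearMap.ker_le_ker_comp a c) }
  have hsq : ∀ x ∈ K, ∀ y ∈ K, x * y = 0 := by
    rintro x ⟨-, hxk⟩ y ⟨hyr, -⟩
    ext v
    rw [Module.End.mul_apply, LinearMap.zero_apply]
    exact LinearMap.mem_ker.mp (hxk (hyr (LinearMap.mem_range_self y v)))
  exact eq_zero_of_mem_of_forall_mul_eq_zero hsq (show g ∈ K from ⟨hgr, hgk⟩)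

/-- «Our next step is to show that `Hom(X, Y) = 0`»: an endomorphism `f` of `Y` vanishing on `Z` is zero.  (`f` factors
through the simple `X = Y ⧸ Z`, so `f(Y)` is semisimple, hence `f(Y) ⊆ Z` by `le_of_isCoatom_of_isSemisimpleModule` —
this replaces the printed splitting `p ∘ f = id_X` — and then `f ∈ Hom(X, Z) = 0`.)
[cite: Kottwitz1992, §3 Lemma 3.1 (proof, p. 383)] -/
theorem eq_zero_of_le_ker [IsSemisimpleRing (Module.End R Y)] {Z : Submodule R Y} (hZ : IsCoatom Z)
    (hZss : IsSemisimpleModule R Z) (hY : ¬ IsSemisimpleModule R Y) {f : Module.End R Y}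
    (hfk : Z ≤ LinearMap.ker f) : f = 0 := by
  haveI : IsSimpleModule R (Y ⧸ Z) := isSimpleModule_iff_isCoatom.mpr hZ
  have hrange : LinearMap.range (Z.liftQ f hfk) = LinearMap.range f := Submodule.range_liftQ _ _ _
  have hss : IsSemisimpleModule R (LinearMap.range f) := by
    rw [← hrange]
    exact IsSemisimpleModule.range _
  exact eq_zero_of_range_le_of_le_ker hZ hZss hY (le_of_isCoatom_of_isSemisimpleModule hZ hZss hY hss) hfk

/-- A homomorphism `X = Y ⧸ Z → Y` is zero («`Hom(X, Y) = 0`», quotient form of `eq_zero_of_le_ker`).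
[cite: Kottwitz1992, §3 Lemma 3.1 (proof, p. 383)] -/
theorem eq_zero_of_isCoatom_quotient [IsSemisimpleRing (Module.End R Y)] {Z : Submodule R Y} (hZ : IsCoatom Z)
    (hZss : IsSemisimpleModule R Z) (hY : ¬ IsSemisimpleModule R Y) (φ : (Y ⧸ Z) →ₗ[R] Y) : φ = 0 := by
  have hcomp : φ ∘ₗ Z.mkQ = 0 :=
    eq_zero_of_le_ker hZ hZss hY (f := φ ∘ₗ Z.mkQ) (by
      intro z hz
      rw [LinearMap.mem_ker, LinearMap.comp_apply, Submodule.mkQ_apply, (Submodule.Quotient.mk_eq_zero Z).mpr hz,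
        map_zero])
  ext y
  · have := LinearMap.congr_fun hcomp y
    rw [LinearMap.comp_apply, Submodule.mkQ_apply, LinearMap.zero_apply] at this
    rw [LinearMap.comp_apply, Submodule.mkQ_apply, LinearMap.zero_comp, LinearMap.zero_apply]
    exact this

/-- **The core of Lemma 3.1, length-free.**  Let `Z ⊆ Y` be a maximal submodule (`Y ⧸ Z` simple) which is semisimple, and
suppose the rings `End(Y)` and `End(Y⧸Z ⊕ Y)` are semisimple.  Then `Y` is semisimple: otherwise «since `Hom(X, Y) = 0`,
the semisimple ring `End(X ⊕ Y)` has as two-sided ideal the group `Hom(Y, X)` with the zero multiplication law, and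
therefore `Hom(Y, X) = 0`.  This is a contradiction, since `p` is a nonzero element of `Hom(Y, X)`.»
[cite: Kottwitz1992, §3 Lemma 3.1 (proof, p. 383)] -/
theorem isSemisimpleModule_of_isCoatom [IsSemisimpleRing (Module.End R Y)] (Z : Submodule R Y) (hZ : IsCoatom Z)
    (hZss : IsSemisimpleModule R Z) [IsSemisimpleRing (Module.End R ((Y ⧸ Z) × Y))] : IsSemisimpleModule R Y := by
  by_contra hY
  haveI : IsSimpleModule R (Y ⧸ Z) := isSimpleModule_iff_isCoatom.mpr hZ
  -- `Hom(X, Y) = 0`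
  have hXY : ∀ φ : (Y ⧸ Z) →ₗ[R] Y, φ = 0 := eq_zero_of_isCoatom_quotient hZ hZss hY
  -- the ideal `Hom(Y, X)` of `End(X ⊕ Y)`: endomorphisms `F` with `F(X ⊕ Y) ⊆ X ⊕ 0` and `F(X ⊕ 0) = 0`
  let J : Ideal (Module.End R ((Y ⧸ Z) × Y)) :=
    { carrier := {F | LinearMap.snd R (Y ⧸ Z) Y ∘ₗ F = 0 ∧ F ∘ₗ LinearMap.inl R (Y ⧸ Z) Y = 0}
      add_mem' := by
        rintro a b ⟨ha1, ha2⟩ ⟨hb1, hb2⟩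
        exact ⟨by rw [LinearMap.comp_add, ha1, hb1, add_zero], by rw [LinearMap.add_comp, ha2, hb2, add_zero]⟩
      zero_mem' := ⟨LinearMap.comp_zero _, LinearMap.zero_comp _⟩
      smul_mem' := by
        rintro G F ⟨hF1, hF2⟩
        refine ⟨?_, ?_⟩
        · -- `snd ∘ G ∘ F = (snd ∘ G ∘ inl) ∘ (fst ∘ F) = 0`, because `snd ∘ G ∘ inl ∈ Hom(X, Y) = 0`
          have hGXY : LinearMap.snd R (Y ⧸ Z) Y ∘ₗ G ∘ₗ LinearMap.inl R (Y ⧸ Z) Y = 0 := hXY _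
          rw [smul_eq_mul, Module.End.mul_eq_comp]
          refine LinearMap.ext fun w => ?_
          have h2 : (F w).2 = 0 := by
            have := LinearMap.congr_fun hF1 w
            rwa [LinearMap.comp_apply, LinearMap.snd_apply, LinearMap.zero_apply] at this
          have hw : F w = LinearMap.inl R (Y ⧸ Z) Y (F w).1 := by
            rw [LinearMap.inl_apply]
            exact Prod.ext rfl h2
          have := LinearMap.congr_fun hGXY (F w).1
          rw [LinearMap.comp_apply, LinearMap.comp_apply, LinearMap.zero_apply] at this
          rw [LinearMap.comp_apply, LinearMap.comp_apply, LinearMap.zero_apply, hw]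
          exact this
        · rw [smul_eq_mul, Module.End.mul_eq_comp, LinearMap.comp_assoc, hF2, LinearMap.comp_zero] }
  have hsq : ∀ F ∈ J, ∀ F' ∈ J, F * F' = 0 := by
    rintro F ⟨-, hF2⟩ F' ⟨hF'1, -⟩
    refine LinearMap.ext fun w => ?_
    have h2 : (F' w).2 = 0 := by
      have := LinearMap.congr_fun hF'1 w
      rwa [LinearMap.comp_apply, LinearMap.snd_apply, LinearMap.zero_apply] at this
    have hw : F' w = LinearMap.inl R (Y ⧸ Z) Y (F' w).1 := by
      rw [LinearMap.inl_apply]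
      exact Prod.ext rfl h2
    have := LinearMap.congr_fun hF2 (F' w).1
    rw [LinearMap.comp_apply, LinearMap.zero_apply] at this
    rw [Module.End.mul_apply, LinearMap.zero_apply, hw]
    exact this
  -- `p : Y → X`, placed in `End(X ⊕ Y)` as `(x, y) ↦ (p y, 0)`, lies in `J` and is nonzero
  let P : Module.End R ((Y ⧸ Z) × Y) :=
    LinearMap.inl R (Y ⧸ Z) Y ∘ₗ Z.mkQ ∘ₗ LinearMap.snd R (Y ⧸ Z) Y
  have hP : P ∈ J := by
    refine ⟨LinearMap.ext fun w => ?_, LinearMap.ext fun x => ?_⟩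
    · simp [P]
    · simp [P]
  have hP0 : P = 0 := eq_zero_of_mem_of_forall_mul_eq_zero hsq hP
  -- but `p ≠ 0`: `X` is simple, hence nontrivial
  haveI : Nontrivial (Y ⧸ Z) := IsSimpleModule.nontrivial R (Y ⧸ Z)
  obtain ⟨x, hx⟩ := exists_ne (0 : Y ⧸ Z)
  obtain ⟨y, rfl⟩ := Submodule.mkQ_surjective Z x
  have h0 := LinearMap.congr_fun hP0 ((0 : Y ⧸ Z), y)
  have h1 : Z.mkQ y = 0 := by
    simpa [P] using congrArg Prod.fst h0
  exact hx h1

end Core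

/-! ## §2 Lemma 3.1 for the category of modules of finite length -/

section FiniteLength

variable {R : Type u} [Ring R]

/-- A module of finite length is Noetherian and Artinian (Mathlib's `isFiniteLength_iff_isNoetherian_isArtinian`),
recorded as a pair of instances-on-demand. [cite: Kottwitz1992, §3 p. 382 («every object in `𝒞` has finite length»)] -/
theorem isNoetherian_and_isArtinian_of_isFiniteLength {M : Type v} [AddCommGroup M] [Module R M]
    (hM : IsFiniteLength R M) : IsNoetherian R M ∧ IsArtinian R M :=
  isFiniteLength_iff_isNoetherian_isArtinian.mp hM

/-- **KOTTWITZ 1992, LEMMA 3.1** for `𝒞` = the `R`-modules of finite length over a ring `R`: «Suppose that for every object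
`X` of `𝒞` the endomorphism ring `End(X)` is semisimple.  Then `𝒞` is semisimple.»  Proved by the printed induction on the
length: for `Y` of positive length choose a maximal submodule `Z` (`X = Y⧸Z` simple); `Z` has smaller length, so it is
semisimple by induction, and `isSemisimpleModule_of_isCoatom` (the hypothesis being used for `Y` and for `X ⊕ Y`, both of
finite length) shows that `Y` is semisimple. [cite: Kottwitz1992, §3 Lemma 3.1 (p. 383)] -/
theorem isSemisimpleModule_of_forall_isSemisimpleRing_moduleEnd
    (h : ∀ (N : Type v) [AddCommGroup N] [Module R N], IsFiniteLength R N → IsSemisimpleRing (Module.End R N))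
    {M : Type v} [AddCommGroup M] [Module R M] (hM : IsFiniteLength R M) : IsSemisimpleModule R M := by
  -- induction on the length, for all modules of the universe at once
  suffices main : ∀ (n : ℕ) (N : Type v) [AddCommGroup N] [Module R N],
      IsFiniteLength R N → Module.length R N = n → IsSemisimpleModule R N by
    obtain ⟨_, _⟩ := isFiniteLength_iff_isNoetherian_isArtinian.mp hM
    obtain ⟨n, hn⟩ := ENat.ne_top_iff_exists.mp (Module.length_ne_top (R := R) (M := M))
    exact main n M hM hn.symm
  intro n
  induction n using Nat.strong_induction_on with
  | _ n ih =>
    intro N _ _ hN hn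
    obtain ⟨_, _⟩ := isFiniteLength_iff_isNoetherian_isArtinian.mp hN
    by_cases htriv : Subsingleton N
    · -- length `0`: «there is nothing to do»
      haveI : Subsingleton (Submodule R N) := (Submodule.subsingleton_iff R).mpr htriv
      exact IsSemisimpleModule.of_sSup_simples_eq_top (Subsingleton.elim _ _)
    · rw [not_subsingleton_iff_nontrivial] at htriv
      -- «Let `Z` be a subobject of `Y` such that the quotient `X := Y/Z` is simple»
      obtain ⟨Z, hZ, -⟩ := (eq_top_or_exists_le_coatom (⊥ : Submodule R N)).resolve_left bot_ne_top
      -- «By the induction hypothesis `Z` is semisimple»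
      have hZfl : IsFiniteLength R Z := IsFiniteLength.of_injective (f := Z.subtype) hN Z.injective_subtype
      obtain ⟨_, _⟩ := isFiniteLength_iff_isNoetherian_isArtinian.mp hZfl
      have hZlt : Module.length R Z < Module.length R N := Submodule.length_lt hZ.1
      obtain ⟨m, hm⟩ := ENat.ne_top_iff_exists.mp (Module.length_ne_top (R := R) (M := Z))
      have hmn : m < n := by
        rw [← hm, hn] at hZlt
        exact_mod_cast hZlt
      have hZss : IsSemisimpleModule R Z := ih m hmn Z hZfl hm.symm
      -- the hypothesis, used for `Y` and for `X ⊕ Y`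
      haveI := h N hN
      have hXY : IsFiniteLength R ((N ⧸ Z) × N) :=
        isFiniteLength_iff_isNoetherian_isArtinian.mpr ⟨inferInstance, inferInstance⟩
      haveI := h ((N ⧸ Z) × N) hXY
      exact isSemisimpleModule_of_isCoatom Z hZ hZss

/-- «If `𝒞` is semisimple, then for every object `X` of `𝒞` the endomorphism ring `End(X)` is semisimple.  There is also a
converse.» — for `𝒞` = the `R`-modules of finite length: ALL of them are semisimple iff ALL their endomorphism rings are
semisimple rings (forward direction: Mathlib's `IsSemisimpleRing.moduleEnd`, a finite-length module being finitely
generated; converse: Lemma 3.1). [cite: Kottwitz1992, §3 Lemma 3.1 and the preceding paragraph (p. 383)] -/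
theorem forall_isSemisimpleModule_iff_forall_isSemisimpleRing_moduleEnd :
    (∀ (N : Type v) [AddCommGroup N] [Module R N], IsFiniteLength R N → IsSemisimpleModule R N) ↔
      ∀ (N : Type v) [AddCommGroup N] [Module R N], IsFiniteLength R N → IsSemisimpleRing (Module.End R N) := by
  constructor
  · intro hss N _ _ hN
    haveI := hss N hN
    obtain ⟨_, _⟩ := isFiniteLength_iff_isNoetherian_isArtinian.mp hN
    exact IsSemisimpleRing.moduleEnd R N
  · intro h N _ _ hN
    exact isSemisimpleModule_of_forall_isSemisimpleRing_moduleEnd h hN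

/-- Instance-flavoured reading of Lemma 3.1: if every Noetherian and Artinian `R`-module has a semisimple endomorphism
ring, then every Noetherian and Artinian `R`-module is semisimple. [cite: Kottwitz1992, §3 Lemma 3.1 (p. 383)] -/
theorem isSemisimpleModule_of_forall_isSemisimpleRing_moduleEnd'
    (h : ∀ (N : Type v) [AddCommGroup N] [Module R N] [IsNoetherian R N] [IsArtinian R N],
      IsSemisimpleRing (Module.End R N))
    (M : Type v) [AddCommGroup M] [Module R M] [IsNoetherian R M] [IsArtinian R M] : IsSemisimpleModule R M :=
  isSemisimpleModule_of_forall_isSemisimpleRing_moduleEnd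
    (fun N _ _ hN => by
      obtain ⟨_, _⟩ := isFiniteLength_iff_isNoetherian_isArtinian.mp hN
      exact h N)
    (isFiniteLength_iff_isNoetherian_isArtinian.mpr ⟨inferInstance, inferInstance⟩)

end FiniteLength

end Literature.RingTheory.SimpleModule
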